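import Summits.Ventures.Crystal3D.Theorems.StickyWulffConstantNoReconstructionGainLocalFilm
import HarnessLib

/-!
# Ball-by-ball certificates, II: only the SUPPORTING contacts of a ball need few lines

HONEST FRAMING. Part of the venture `Summits/Ventures/Crystal3D` (cell `crystal3d-full`), helper
`--supports` the crux `NoReconstructionGain` (stmt-Ventures-19144, route
`route-Ventures-StickyWulffConstant`), line `adhesion`; continuation of `…LocalFilm`
(`localBarlowFilm_adhesion`).  The few-lines certificate (a) there asked ALL partners of the ball to
lie on at most six lines through it; but under the `ν`-height potential the partners that are film
balls strictly `ν`-ABOVE the ball cost nothing and need no line (`antipodal_noGainPotential_of_above`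
exempts them).  So certificate (a) is replaced by

  (a') the partners of `q` that are NOT film balls strictly `ν`-above `q` lie on `≤ 6` lines through `q`

— in particular every film ball with at most six such "supporting" contacts is certified, whatever its
shell.  The Barlow certificates (b), (c), (d) are unchanged:

* `supportedFilm_adhesion` (**the rung**, `R = 1`, `C = 0`; registered by name).

WHAT THIS IS NOT: balls with `≥ 7` supporting contacts on `≥ 7` lines outside the two Barlow frames;
films below the cut; rung F-C1 not moved.
-/

noncomputable section

namespace Summit.Ventures.Crystal3D.Theorems

open Summit.Ventures.Crystal3D Finset
open Literature.MathematicalPhysics.StatisticalMechanics (barlowPos barlowStacking fccStacking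
  barlowOffset constHagg haggLabel_const barlowPos_apply_zero barlowPos_apply_one barlowPos_apply_two
  orderedContacts contactDeficiency)
open scoped InnerProductSpace

/-- **The atom from ball-by-ball certificates, supporting-contact form** (`R = 1`, `C = 0`;
registered by name on stmt-Ventures-19144): above the cut, every film ball has its supporting
partners (all but the strictly `ν`-higher film balls) on `≤ 6` lines, or is locally basal Barlow
(`ν₃² > 1/3`), locally Barlow of the `R_t`-family (`(R_t ν)₃² > 1/3`), or locally two-family. -/
theorem supportedFilm_adhesion :
    ∃ R C : ℝ, 1 ≤ R ∧ ∀ ν : EuclideanSpace ℝ (Fin 3), ‖ν‖ = 1 → ∀ ρ : ℝ, R ≤ ρ →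
      ∀ X P : Finset (EuclideanSpace ℝ (Fin 3)),
      (∀ p ∈ X, ∀ q ∈ X, p ≠ q → 1 ≤ dist p q) → P ⊆ X →
      (∀ p, p ∈ P ↔ (p ∈ fccStacking 1 (Real.sqrt (2 / 3)) ∧ -(2 * R) ≤ ⟪p, ν⟫_ℝ ∧
        ⟪p, ν⟫_ℝ ≤ -R ∧ ‖p‖ ^ 2 - ⟪p, ν⟫_ℝ ^ 2 ≤ ρ ^ 2)) →
      (∀ q ∈ X \ P, -R < ⟪q, ν⟫_ℝ) →
      (∀ q ∈ X \ P,
        (∃ W : Finset (EuclideanSpace ℝ (Fin 3)), W.card ≤ 6 ∧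
            ∀ x ∈ X, dist q x = 1 → (x ∉ P ∧ ⟪q, ν⟫_ℝ < ⟪x, ν⟫_ℝ) ∨ ∃ w ∈ W, x = q + w ∨ x = q - w) ∨
        (1 / 3 < ν 2 ^ 2 ∧ ∀ x ∈ X, dist q x = 1 →
            x - q ∈ fccStacking 1 (Real.sqrt (2 / 3)) ∨
            x - q - barlowOffset 1 ∈ fccStacking 1 (Real.sqrt (2 / 3)) ∨
            x - q + barlowOffset 1 ∈ fccStacking 1 (Real.sqrt (2 / 3))) ∨
        (1 / 3 < (2 * ⟪ν, barlowPos 1 (Real.sqrt (2 / 3)) constHagg 1 0 0⟫_ℝ * Real.sqrt (2 / 3) - ν 2) ^ 2 ∧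
          ∀ x ∈ X, dist q x = 1 →
            x - q ∈ fccStacking 1 (Real.sqrt (2 / 3)) ∨
            x - q - ((2 / 3 : ℝ) • barlowPos 1 (Real.sqrt (2 / 3)) constHagg 1 0 0 - barlowOffset 1) ∈
              fccStacking 1 (Real.sqrt (2 / 3)) ∨
            x - q + ((2 / 3 : ℝ) • barlowPos 1 (Real.sqrt (2 / 3)) constHagg 1 0 0 - barlowOffset 1) ∈
              fccStacking 1 (Real.sqrt (2 / 3))) ∨
        (1 / 3 < ν 2 ^ 2 ∧
          1 / 3 < (2 * ⟪ν, barlowPos 1 (Real.sqrt (2 / 3)) constHagg 1 0 0⟫_ℝ * Real.sqrt (2 / 3) - ν 2) ^ 2 ∧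
          ∀ x ∈ X, dist q x = 1 →
            x - q ∈ fccStacking 1 (Real.sqrt (2 / 3)) ∨
            x - q - barlowOffset 1 ∈ fccStacking 1 (Real.sqrt (2 / 3)) ∨
            x - q + barlowOffset 1 ∈ fccStacking 1 (Real.sqrt (2 / 3)) ∨
            x - q - ((2 / 3 : ℝ) • barlowPos 1 (Real.sqrt (2 / 3)) constHagg 1 0 0 - barlowOffset 1) ∈
              fccStacking 1 (Real.sqrt (2 / 3)) ∨
            x - q + ((2 / 3 : ℝ) • barlowPos 1 (Real.sqrt (2 / 3)) constHagg 1 0 0 - barlowOffset 1) ∈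
              fccStacking 1 (Real.sqrt (2 / 3)))) →
      ((((P ×ˢ (X \ P)).filter fun pq => dist pq.1 pq.2 = 1).card : ℕ) : ℝ) ≤
        contactDeficiency (X \ P) + C * ρ := by
  classical
  refine ⟨1, 0, le_rfl, fun ν hν ρ hρ X P hX hPX hP habove hcert => ?_⟩
  rw [zero_mul, add_zero]
  obtain ⟨Rt, hRt⟩ := exists_halfTurn_t
  obtain ⟨w, hw⟩ : ∃ w : EuclideanSpace ℝ (Fin 3), w = barlowOffset 1 := ⟨_, rfl⟩
  obtain ⟨w', hw'⟩ : ∃ w' : EuclideanSpace ℝ (Fin 3),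
      w' = (2 / 3 : ℝ) • barlowPos 1 (Real.sqrt (2 / 3)) constHagg 1 0 0 - barlowOffset 1 := ⟨_, rfl⟩
  rw [← hw', ← hw] at hcert
  have hRw : Rt w = w' := by rw [hw, hw', halfTurn_barlowOffset Rt hRt]
  have hRR : ∀ x, Rt (Rt x) = x := halfTurn_halfTurn Rt hRt
  have hRw' : Rt w' = w := by rw [← hRw, hRR]
  have hRmem : ∀ p, p ∈ fccStacking 1 (Real.sqrt (2 / 3)) → Rt p ∈ fccStacking 1 (Real.sqrt (2 / 3)) :=
    fun p hp => halfTurn_mem Rt hRt hp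
  have hR2 : (Rt ν) 2 = 2 * ⟪ν, barlowPos 1 (Real.sqrt (2 / 3)) constHagg 1 0 0⟫_ℝ * Real.sqrt (2 / 3) - ν 2 :=
    halfTurn_apply_two Rt hRt ν
  -- a linear function is midpoint-affine
  have hconv : ∀ q z : EuclideanSpace ℝ (Fin 3), 2 * ⟪q, ν⟫_ℝ ≤ ⟪q + z, ν⟫_ℝ + ⟪q - z, ν⟫_ℝ := by
    intro q z; rw [inner_add_left, inner_sub_left]; exact le_of_eq (by ring)
  -- relative `w'`-classes become relative basal classes under `R_t`
  have hRrel : ∀ d : EuclideanSpace ℝ (Fin 3),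
      (d ∈ fccStacking 1 (Real.sqrt (2 / 3)) ∨ d - w' ∈ fccStacking 1 (Real.sqrt (2 / 3)) ∨
        d + w' ∈ fccStacking 1 (Real.sqrt (2 / 3))) →
      (Rt d ∈ fccStacking 1 (Real.sqrt (2 / 3)) ∨ Rt d - w ∈ fccStacking 1 (Real.sqrt (2 / 3)) ∨
        Rt d + w ∈ fccStacking 1 (Real.sqrt (2 / 3))) := by
    intro d h
    rcases h with h | h | h
    · exact Or.inl (hRmem _ h)
    · refine Or.inr (Or.inl ?_); have := hRmem _ h; rwa [map_sub, hRw'] at this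
    · refine Or.inr (Or.inr ?_); have := hRmem _ h; rwa [map_add, hRw'] at this
  set f : EuclideanSpace ℝ (Fin 3) → ℝ := fun y => ⟪y, ν⟫_ℝ with hf
  set Φ : EuclideanSpace ℝ (Fin 3) → ℤ := fun x => (((X \ P).filter fun y => f y < f x).card : ℤ) with hΦ
  have hmain := cross_le_of_potential X P ∅ hX hPX (empty_subset _) Φ fun q hq => by
    rw [sdiff_empty] at hq
    have hlt : ∀ x ∈ X \ P, dist q x = 1 → (Φ x < Φ q ↔ ⟪x, ν⟫_ℝ < ⟪q, ν⟫_ℝ) := fun x hx _ => by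
      simp only [hΦ]; exact rank_lt_iff (X \ P) f x q hx
    have heq : ∀ x ∈ X \ P, dist q x = 1 → (Φ x = Φ q ↔ ⟪x, ν⟫_ℝ = ⟪q, ν⟫_ℝ) := fun x hx _ => by
      simp only [hΦ]; exact rank_eq_iff (X \ P) f x q hx hq
    have hplug : ∀ p ∈ P, dist q p = 1 → ⟪p, ν⟫_ℝ < ⟪q, ν⟫_ℝ := by
      intro p hp _
      obtain ⟨_, _, hp2, _⟩ := (hP p).1 hp
      exact lt_of_le_of_lt hp2 (habove q hq)
    rcases hcert q hq with ⟨W, hWcard, hW⟩ | ⟨hν3, hrel⟩ | ⟨hν3b, hrel⟩ | ⟨hν3, hν3b, hrel⟩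
    · -- (a) few lines: the antipodal lemma with `R` = non-above film partners
      obtain ⟨Rset, hRset⟩ : ∃ S : Finset (EuclideanSpace ℝ (Fin 3)),
          S = (X \ P).filter fun x => ⟪x, ν⟫_ℝ ≤ ⟪q, ν⟫_ℝ := ⟨_, rfl⟩
      have hRsub : Rset ⊆ X \ P := by rw [hRset]; exact filter_subset _ _
      refine antipodal_noGainPotential_of_above X P Rset hPX hRsub q Φ (fun y => ⟪y, ν⟫_ℝ)
        (fun x hx hd => ?_) (fun x hx hd => hlt x (hRsub hx) hd) (fun x hx hd => heq x (hRsub hx) hd)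
        hplug (hconv q) W hWcard (fun x hx hd hxR => ?_)
      swap
      · -- a supporting partner is on a line of `W`; a strictly higher film partner is exempt
        rcases hW x hx hd with ⟨hxP, hup⟩ | h
        · exfalso
          refine hxR (mem_sdiff.2 ⟨mem_sdiff.2 ⟨hx, hxP⟩, fun hxRset => ?_⟩)
          rw [hRset] at hxRset
          exact (not_le.2 hup) (mem_filter.1 hxRset).2
        · exact h
      have hxQ : x ∈ X \ P := (mem_sdiff.1 hx).1
      have hnot : ¬ ⟪x, ν⟫_ℝ ≤ ⟪q, ν⟫_ℝ := fun hle =>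
        (mem_sdiff.1 hx).2 (by rw [hRset]; exact mem_filter.2 ⟨hxQ, hle⟩)
      have h1 : ¬ Φ x < Φ q := fun hl => hnot ((hlt x hxQ hd).1 hl).le
      have h2 : ¬ Φ x = Φ q := fun he => hnot ((heq x hxQ hd).1 he).le
      exact lt_of_le_of_ne (not_lt.1 h1) (Ne.symm h2)
    · -- (b) locally basal Barlow
      refine basal_noGainPotential X P hX hPX q Φ ν hν hν3 hlt heq hplug fun x hx hd => ?_
      have h := hrel x hx hd
      rw [hw] at h
      exact relBasal_shape h hd
    · -- (c) locally Barlow of the second family: transport through `R_t`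
      have hν3' : 1 / 3 < (Rt ν) 2 ^ 2 := by rw [hR2]; exact hν3b
      have hgi : Isometry (Rt : EuclideanSpace ℝ (Fin 3) → EuclideanSpace ℝ (Fin 3)) := Rt.isometry
      refine noGainIneq_of_isometry Rt X P q Φ ?_
      have hXp : ∀ p ∈ X.image Rt, ∀ q ∈ X.image Rt, p ≠ q → 1 ≤ dist p q := by
        intro p hp q' hq' hpq
        obtain ⟨p₀, hp₀, rfl⟩ := mem_image.1 hp
        obtain ⟨q₀, hq₀, rfl⟩ := mem_image.1 hq'
        rw [hgi.dist_eq]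
        exact hX p₀ hp₀ q₀ hq₀ fun e => hpq (by rw [e])
      have hsd : X.image Rt \ P.image Rt = (X \ P).image Rt := (image_sdiff X P Rt.injective).symm
      refine basal_noGainPotential (X.image Rt) (P.image Rt) hXp (image_subset_image hPX) (Rt q)
        (fun y => Φ (Rt.symm y)) (Rt ν) (by rw [LinearIsometryEquiv.norm_map, hν]) hν3'
        (fun y hy hd => ?_) (fun y hy hd => ?_) (fun p hp hd => ?_) (fun y hy hd => ?_)
      · rw [hsd] at hy
        obtain ⟨x, hx, rfl⟩ := mem_image.1 hy
        rw [Rt.symm_apply_apply, Rt.symm_apply_apply, LinearIsometryEquiv.inner_map_map,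
          LinearIsometryEquiv.inner_map_map]
        exact hlt x hx (by rw [← Rt.dist_map]; exact hd)
      · rw [hsd] at hy
        obtain ⟨x, hx, rfl⟩ := mem_image.1 hy
        rw [Rt.symm_apply_apply, Rt.symm_apply_apply, LinearIsometryEquiv.inner_map_map,
          LinearIsometryEquiv.inner_map_map]
        exact heq x hx (by rw [← Rt.dist_map]; exact hd)
      · obtain ⟨p₀, hp₀, rfl⟩ := mem_image.1 hp
        rw [LinearIsometryEquiv.inner_map_map, LinearIsometryEquiv.inner_map_map]
        exact hplug p₀ hp₀ (by rw [← Rt.dist_map]; exact hd)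
      · obtain ⟨x, hx, rfl⟩ := mem_image.1 hy
        have hd' : dist q x = 1 := by rw [← Rt.dist_map]; exact hd
        have h := hRrel (x - q) (hrel x hx hd')
        rw [map_sub, hw] at h
        exact relBasal_shape h hd
    · -- (d) locally two-family: the lattice-ball count
      have hν3' : 1 / 3 < (Rt ν) 2 ^ 2 := by rw [hR2]; exact hν3b
      refine twoFamily_lattice_noGainPotential X P hX hPX q Φ ν hν hν3 Rt hRt hν3' hlt heq hplug
        fun x hx hd => ?_
      rw [← hw]
      rcases hrel x hx hd with h | h | h | h | h
      · exact Or.inl h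
      · exact Or.inr (Or.inl h)
      · exact Or.inr (Or.inr (Or.inl h))
      · refine Or.inr (Or.inr (Or.inr (Or.inl ?_)))
        have := hRmem _ h; rwa [map_sub, hRw'] at this
      · refine Or.inr (Or.inr (Or.inr (Or.inr ?_)))
        have := hRmem _ h; rwa [map_add, hRw'] at this
  simpa using hmain

end Summit.Ventures.Crystal3D.Theorems

end
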